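import Summits.QuantumFields.YangMills.Theorems.UnitScaleTiltProp7AxialGaugeFace
import Summits.QuantumFields.YangMills.Theorems.UnitScaleTiltProp7AxialSpace18
import HarnessLib

/-!
# Route `UnitScaleTilt`, crux K1 child «MinimiserStabilityRegPr» (stmt-QuantumFields-19200), registered stub `stub_prop7From14` (skeleton birth_v7
# cc37a178…; leaf V3 «Prop 7 from a background (14)») — [Balaban1985RegularSpaces] LEMMA 1 AT THE d = 3 CARRIER, ASSEMBLED: two elements `W, U₀` of ONE
# regular fibre `𝔘_k(·) ∩ 𝔅_k(V)`, `W` moved inside the group (4) to the complete comb axial gauge relative to `U₀`, differ by `‖W_bU₀,b* − 1‖ ≤ 113(ε₀ + e₀)`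
# on EVERY bond and by `≤ 3(ε₀ + e₀)·L^{−(K−n)}` inside the blocks — uniformly in `k = K − n` (block size `L ≥ 7`, `50(500L + 7L²)·e ≤ 1`)

Cell `ym3-torus` ∕ fleet seat `ym-ust-19200-p1` (gen 7; HUMAN RULING D-0037, YM ladder rung R3).  The capstone of this seat's five files on print's space (18):
`…Prop7AxialGauge` (the comb axial gauge inside (4), one element per orbit), `…AxialGaugeSup` ∕ `…AxialGaugeBlock` (interior bonds, `O(ε₀η)`), `…AxialSpace18`
(packaging in (6)), `…AxialGaugeFace` (face bonds, `O(ε₀)`, via the ★19200-p2 lineage's transport comparison).  Here: the dichotomy «interior or face» for a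
bond of the finest torus relative to the `k`-blocks, the identification of the two `k`-fold (0.4)-averages of two elements of one fibre, and the assembled
statement — print's [Balaban1985RegularSpaces] Lemma 1 (1.24)–(1.25) «|V′ − 1| < 4d²α₀ + α₁» in its `k`-fold relative form for the item's averaging, the sup-norm
input of [Balaban1985RegularSpaces] Thm 2 (= [Balaban1985Variational] Prop. 2, the pillar V3-A of the leaf).

WHAT IS PROVED (sorry-free, no definition).
* `iterBlockOf_shift_of_not_face`: a bond that does not leave through a face stays in its `k`-block; `face_or_interior`.
* `iter_eq_of_mem_fibre`: `W, U₀ ∈ 𝔅_k(V)` ⟹ their `(K−n)`-fold (0.4)-averages coincide.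
* **`norm_pertVar_le_of_combAxial_of_mem_fibre_T3`**: `W ∈ 𝔘_k(ε₀) ∩ 𝔅_k(V)`, `U₀ ∈ 𝔘_k(e₀) ∩ 𝔅_k(V)`, `W` comb-axial relative to `U₀` ⟹
  `‖pertVar U₀ W b‖ ≤ 113·(ε₀ + e₀)` for every bond `b`.
* **`exists_axial18_sup`**: for every `W ∈ 𝔘_k(ε₀) ∩ 𝔅_k(V)` and background `U₀ ∈ 𝔘_k(e₀) ∩ 𝔅_k(V)` there is `v` in (4) with `W^v` in the same regular
  fibre, comb-axial relative to `U₀`, `‖pertVar U₀ W^v b‖ ≤ 113(ε₀ + e₀)` on all bonds and `≤ 3(ε₀ + e₀)L^{−(K−n)}` on interior bonds.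

HONEST SCOPE.  `L ≥ 7` and the smallness `50(500L + 7L²)·e ≤ 1` of both radii (inherited from `IterPlaqSmall`); background IN the fibre (print's (14) allows
`|Ū₀ − V| < C₁ε₁` — then `…AxialGaugeFace.dist1_mul_inv_le_face_T3` with `β = C₁ε₁`-type middle term applies instead); constants crude.  Thm 2 itself is not
touched.

References: T. Bałaban, CMP 99 (1985) 75–102 [Balaban1985RegularSpaces] (Lemma 1 (1.24)–(1.25) p.79); CMP 102 (1985) 277–309 [Balaban1985Variational] ((2)–(4),
(6) p.278, (14), (18) p.280).
-/

noncomputable section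

namespace Summit.QuantumFields.YangMills.Theorems.Prop7AxialLemma1

open scoped Matrix.Norms.L2Operator
open Literature.MathematicalPhysics.QuantumFieldTheory.Balaban1983to89
open T4Continuum BlockAveraging
open B10Eq27TorusAxialLog (axialT)
open B5Eq118OneStroke (iterBlockOf val_iterBlockOf)
open B15DeterminingSets (embIter)
open Summit.QuantumFields.YangMills.Theorems.Prop7FlatHolonomy (sitesPerDir_zero_eq_mul_pow)
open Literature.MathematicalPhysics.QuantumFieldTheory.Balaban1983to89.T3ContinuumYM3Torus
open Literature.MathematicalPhysics.QuantumFieldTheory.Balaban1983to89.T3LevelShift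
open Literature.MathematicalPhysics.QuantumFieldTheory.Balaban1983to89.T3UnitLawDensityEML (ℰp)
open Literature.MathematicalPhysics.QuantumFieldTheory.Balaban1983to89.T3TiltDescent (descendTo)
open Literature.MathematicalPhysics.QuantumFieldTheory.Balaban1983to89.T3ConstrainedMinimiser (fibre)
open Literature.MathematicalPhysics.QuantumFieldTheory.Balaban1983to89.T3PrintedRegularMinimiser (RegPr regFibrePr mem_regFibrePr_iff)
open Literature.MathematicalPhysics.QuantumFieldTheory.Balaban1983to89.T3PrintedRegularOrbits (descTransf)
open Literature.MathematicalPhysics.QuantumFieldTheory.Balaban1983to89.T3SectALandauChart (pos_of_regPr)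
open BlockAveragingEMLLinearisedBackground (pertVar)
open Summit.QuantumFields.YangMills.Theorems.Prop7AxialGaugeBlock (norm_pertVar_le_interior_T3)
open Summit.QuantumFields.YangMills.Theorems.Prop7AxialGaugeFace (dist1_mul_inv_le_face_of_descent_eq_T3)
open Summit.QuantumFields.YangMills.Theorems.Prop7AxialSpace18 (exists_axial18)

/-! ## §1 Interior or face -/

section Geometry

variable {P : Params} {k : ℕ}

/-- A bond that does not leave its `k`-block through the face in its own direction stays in the block. [cite: Balaban1984PropagatorsI, (1.6) p.18] -/
theorem iterBlockOf_shift_of_not_face (hk : k ≤ P.m + P.K) (x : Site P 0) (μ : Fin P.d) (hnot : (x μ).val % P.L ^ k ≠ P.L ^ k - 1) :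
    iterBlockOf k (x.shift μ) = iterBlockOf k x := by
  have hN : P.sitesPerDir 0 = P.sitesPerDir k * P.L ^ k := sitesPerDir_zero_eq_mul_pow hk
  have hpos : 0 < P.L ^ k := pow_pos P.L_pos k
  have hNk : 1 ≤ P.sitesPerDir k := (P.one_lt_sitesPerDir k).le
  have hlt : (x μ).val < P.sitesPerDir 0 := ZMod.val_lt _
  have hmodlt : (x μ).val % P.L ^ k < P.L ^ k := Nat.mod_lt _ hpos
  -- `x_μ + 1 < N₀`: otherwise `x_μ = N₀ − 1 ≡ L^k − 1 (mod L^k)`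
  have hx1 : (x μ).val + 1 < P.sitesPerDir 0 := by
    by_contra hc
    have heq : (x μ).val = P.sitesPerDir k * P.L ^ k - 1 := by rw [← hN]; omega
    apply hnot
    rw [heq]
    have hsplit : P.sitesPerDir k * P.L ^ k - 1 = (P.L ^ k - 1) + P.L ^ k * (P.sitesPerDir k - 1) := by
      have h1 : P.sitesPerDir k * P.L ^ k = P.L ^ k + P.L ^ k * (P.sitesPerDir k - 1) := by
        calc P.sitesPerDir k * P.L ^ k = (1 + (P.sitesPerDir k - 1)) * P.L ^ k := by rw [Nat.add_sub_cancel' hNk]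
          _ = P.L ^ k + P.L ^ k * (P.sitesPerDir k - 1) := by ring
      omega
    rw [hsplit, Nat.add_mul_mod_self_left, Nat.mod_eq_of_lt (by omega)]
  funext ν
  apply ZMod.val_injective
  rw [val_iterBlockOf k hk, val_iterBlockOf k hk]
  by_cases hν : ν = μ
  · subst hν
    have hsh : ((x.shift ν) ν).val = (x ν).val + 1 := by
      simp only [Site.shift, Function.update_self]
      rw [ZMod.val_add, ZMod.val_one, Nat.mod_eq_of_lt hx1]
    rw [hsh]
    have hdm := (Nat.div_add_mod ((x ν).val) (P.L ^ k)).symm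
    set q := (x ν).val / P.L ^ k
    set r := (x ν).val % P.L ^ k
    have hr1 : r + 1 < P.L ^ k := by omega
    rw [hdm, add_assoc, Nat.mul_add_div hpos, Nat.div_eq_of_lt hr1, add_zero]
  · have : (x.shift μ) ν = x ν := by simp only [Site.shift]; rw [Function.update_of_ne hν]
    rw [this]

/-- Every bond is a face bond or an interior bond of the `k`-blocks. [cite: Balaban1984PropagatorsI, (1.6) p.18] -/
theorem face_or_interior (hk : k ≤ P.m + P.K) (x : Site P 0) (μ : Fin P.d) :
    (x μ).val % P.L ^ k = P.L ^ k - 1 ∨ iterBlockOf k (x.shift μ) = iterBlockOf k x := by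
  by_cases h : (x μ).val % P.L ^ k = P.L ^ k - 1
  · exact Or.inl h
  · exact Or.inr (iterBlockOf_shift_of_not_face hk x μ h)

end Geometry

/-! ## §2 Two elements of one fibre have the same `k`-fold average -/

section Fibre

variable (F : T3Family) {n K : ℕ} (h : n ≤ K)

/-- `W, U₀ ∈ 𝔅_k(V)` ⟹ the `(K−n)`-fold (0.4)-averages of `W` and `U₀` coincide (the descent `D_{n,K}` is the average read through the level shift).
[cite: Balaban1985Variational, (3) p.278; Balaban1987RG1, (0.11) p.253] -/
theorem iter_eq_of_mem_fibre {V : GaugeField (F.P n) 0 (Matrix.specialUnitaryGroup (Fin 2) ℂ)}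
    {W U₀ : GaugeField (F.P K) 0 (Matrix.specialUnitaryGroup (Fin 2) ℂ)} (hW : W ∈ fibre F ℰp n K h V) (hU₀ : U₀ ∈ fibre F ℰp n K h V) :
    Averaging.iter (fun j => blockAvg (P := F.P K) (j := j) (ExpMeanLog.expMeanLogSU (n := Fin 2))) (K - n) W =
      Averaging.iter (fun j => blockAvg (P := F.P K) (j := j) (ExpMeanLog.expMeanLogSU (n := Fin 2))) (K - n) U₀ := by
  have h1 : descendTo F ℰp n K h W = descendTo F ℰp n K h U₀ := by
    rw [show descendTo F ℰp n K h W = V from hW, show descendTo F ℰp n K h U₀ = V from hU₀]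
  unfold descendTo at h1
  have h2 := congrArg (fieldShift (G := Matrix.specialUnitaryGroup (Fin 2) ℂ)
    (F.sitesPerDir_eq (m := F.m) (K := n) (j := 0) (m' := F.m) (K' := K) (j' := K - n) (by omega)).symm) h1
  rwa [fieldShift_fieldShift_symm, fieldShift_fieldShift_symm] at h2

end Fibre

/-! ## §3 Lemma 1 at the carrier, assembled -/

section Lemma1

variable (F : T3Family) {n K : ℕ} (h : n ≤ K)

/-- **[Balaban1985RegularSpaces] LEMMA 1 AT THE CARRIER — ALL BONDS.**  `L ≥ 7`; `W ∈ 𝔘_k(ε₀) ∩ 𝔅_k(V)`, `U₀ ∈ 𝔘_k(e₀) ∩ 𝔅_k(V)` with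
`50(500L + 7L²)·ε₀ ≤ 1`, `50(500L + 7L²)·e₀ ≤ 1`; `W` in the complete `(K−n)`-fold comb axial gauge relative to `U₀`.  Then for EVERY bond `b`,
`‖pertVar U₀ W b‖ = ‖W_bU₀,b* − 1‖ ≤ 113·(ε₀ + e₀)` — uniformly in `k = K − n` and in the volume.
[cite: Balaban1985RegularSpaces, Lemma 1 (1.25) p.79; Balaban1985Variational, (18) p.280] -/
theorem norm_pertVar_le_of_combAxial_of_mem_fibre_T3 (hL : 7 ≤ F.L) {ε₀ e₀ : ℝ}
    (hε : 50 * (500 * (F.L : ℝ) + 7 * (F.L : ℝ) ^ 2) * ε₀ ≤ 1) (he : 50 * (500 * (F.L : ℝ) + 7 * (F.L : ℝ) ^ 2) * e₀ ≤ 1)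
    {V : GaugeField (F.P n) 0 (Matrix.specialUnitaryGroup (Fin 2) ℂ)} (W U₀ : GaugeField (F.P K) 0 (Matrix.specialUnitaryGroup (Fin 2) ℂ))
    (hW : W ∈ regFibrePr F n K h ε₀ V) (hU₀ : U₀ ∈ regFibrePr F n K h e₀ V)
    (hax : ∀ x : Site (F.P K) 0, axialT W (embIter (K - n) (iterBlockOf (K - n) x)) x = axialT U₀ (embIter (K - n) (iterBlockOf (K - n) x)) x)
    (b : PBond (F.P K) 0) : ‖pertVar U₀ W b‖ ≤ 113 * (ε₀ + e₀) := by
  obtain ⟨x, μ⟩ := b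
  have hWr : RegPr F n K ε₀ W := ((mem_regFibrePr_iff F).mp hW).2
  have hUr : RegPr F n K e₀ U₀ := ((mem_regFibrePr_iff F).mp hU₀).2
  have hε₀ : 0 < ε₀ := pos_of_regPr F hWr
  have he₀ : 0 < e₀ := pos_of_regPr F hUr
  have hk : K - n ≤ (F.P K).m + (F.P K).K := by show K - n ≤ F.m + K; omega
  have hL1 : (1 : ℝ) ≤ (F.L : ℝ) := by exact_mod_cast (show 1 ≤ F.L by omega)
  have hη : (((F.L : ℝ))⁻¹) ^ (K - n) ≤ 1 := pow_le_one₀ (inv_nonneg.mpr (by linarith)) (inv_le_one_of_one_le₀ hL1)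
  have hsum : 0 ≤ ε₀ + e₀ := by linarith
  rcases face_or_interior hk x μ with hface | hint
  · -- face bond
    have hd := dist1_mul_inv_le_face_of_descent_eq_T3 F n K hL hε₀ he₀ hε he W U₀ hWr hUr hax
      (iter_eq_of_mem_fibre F h ((mem_regFibrePr_iff F).mp hW).1 ((mem_regFibrePr_iff F).mp hU₀).1) x μ hface
    change dist1 (W ⟨x, μ⟩ * (U₀ ⟨x, μ⟩)⁻¹) ≤ _
    refine hd.trans ?_
    -- `(100 L^{2k} + 49 L^{2k}/4)·(ε₀+e₀)·L^{−2k} = 112.25 (ε₀+e₀)`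
    have hL0 : (0 : ℝ) < (F.L : ℝ) := by linarith
    have hcancel : (F.L : ℝ) ^ (2 * (K - n)) * (((F.L : ℝ))⁻¹) ^ (2 * (K - n)) = 1 := by
      rw [← mul_pow, mul_inv_cancel₀ hL0.ne', one_pow]
    have : (100 * (F.L : ℝ) ^ (2 * (K - n)) + (7 * (F.L : ℝ) ^ (K - n)) ^ 2 / 4) * ((ε₀ + e₀) * ((F.L : ℝ)⁻¹) ^ (2 * (K - n))) =
        (449 / 4) * (ε₀ + e₀) := by
      have h7 : (7 * (F.L : ℝ) ^ (K - n)) ^ 2 = 49 * (F.L : ℝ) ^ (2 * (K - n)) := by rw [mul_pow, ← pow_mul, mul_comm (K - n) 2]; norm_num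
      rw [h7]
      linear_combination (449 / 4) * (ε₀ + e₀) * hcancel
    rw [this]
    linarith
  · -- interior bond
    have hd := norm_pertVar_le_interior_T3 F n K hε₀.le he₀.le W U₀ hWr hUr hax x μ hint
    refine hd.trans ?_
    nlinarith

/-- **THE AXIAL SPACE (18) WITH ITS SUP-NORM DESCRIPTION — existence inside the group (4).**  For every `W ∈ 𝔘_k(ε₀) ∩ 𝔅_k(V)` and every background
`U₀ ∈ 𝔘_k(e₀) ∩ 𝔅_k(V)` (`L ≥ 7`, both radii with `50(500L + 7L²)·e ≤ 1`) there is `v` with `v↓ = 1` such that `W^v` lies in the same regular fibre, is in the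
complete comb axial gauge relative to `U₀`, and `‖pertVar U₀ W^v b‖ ≤ 113(ε₀ + e₀)` on every bond, `≤ 3(ε₀ + e₀)L^{−(K−n)}` on every interior bond.
[cite: Balaban1985Variational, (18) p.280; Balaban1985RegularSpaces, Lemma 1 (1.25) p.79] -/
theorem exists_axial18_sup (hL : 7 ≤ F.L) {ε₀ e₀ : ℝ}
    (hε : 50 * (500 * (F.L : ℝ) + 7 * (F.L : ℝ) ^ 2) * ε₀ ≤ 1) (he : 50 * (500 * (F.L : ℝ) + 7 * (F.L : ℝ) ^ 2) * e₀ ≤ 1)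
    {V : GaugeField (F.P n) 0 (Matrix.specialUnitaryGroup (Fin 2) ℂ)} (U₀ W : GaugeField (F.P K) 0 (Matrix.specialUnitaryGroup (Fin 2) ℂ))
    (hU₀ : U₀ ∈ regFibrePr F n K h e₀ V) (hW : W ∈ regFibrePr F n K h ε₀ V) :
    ∃ v : GaugeTransf (F.P K) 0 (Matrix.specialUnitaryGroup (Fin 2) ℂ),
      descTransf F n K h v = (fun _ => 1) ∧
      GaugeField.gaugeAct v W ∈ regFibrePr F n K h ε₀ V ∧
      (∀ x : Site (F.P K) 0, axialT (GaugeField.gaugeAct v W) (embIter (K - n) (iterBlockOf (K - n) x)) x =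
        axialT U₀ (embIter (K - n) (iterBlockOf (K - n) x)) x) ∧
      (∀ b : PBond (F.P K) 0, ‖pertVar U₀ (GaugeField.gaugeAct v W) b‖ ≤ 113 * (ε₀ + e₀)) ∧
      ∀ (x : Site (F.P K) 0) (μ : Fin (F.P K).d), iterBlockOf (K - n) (x.shift μ) = iterBlockOf (K - n) x →
        ‖pertVar U₀ (GaugeField.gaugeAct v W) ⟨x, μ⟩‖ ≤ 3 * (ε₀ + e₀) * (((F.L : ℝ))⁻¹) ^ (K - n) := by
  have hUr : RegPr F n K e₀ U₀ := ((mem_regFibrePr_iff F).mp hU₀).2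
  have he₀ : 0 < e₀ := pos_of_regPr F hUr
  obtain ⟨v, hv, hmem, hax, -, -, hint⟩ := exists_axial18 F h he₀.le U₀ W hUr hW
  exact ⟨v, hv, hmem, hax, fun b => norm_pertVar_le_of_combAxial_of_mem_fibre_T3 F h hL hε he _ U₀ hmem hU₀ hax b, hint⟩

open Literature.MathematicalPhysics.QuantumFieldTheory.Balaban1983to89.T3RegularMinimiser (regThreshold) in
/-- **LEMMA 1 AT THE CARRIER FOR A BACKGROUND OF PRINT'S KIND (14)** (`U₀` regular but NOT necessarily in the fibre of `V`; the mismatch of the two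
`(K−n)`-fold (0.4)-averages enters as `β`, print's `α₁ = C₁ε₁`): `W ∈ 𝔘_k(ε₀) ∩ 𝔅_k(V)`, `U₀ ∈ 𝔘_k(e₀)`, `W` comb-axial relative to `U₀`,
`dist1(Ū_W(c)·Ū₀(c)⁻¹) ≤ β` at every coarse bond ⟹ `‖pertVar U₀ W b‖ ≤ 113(ε₀ + e₀) + β` on every bond (`L ≥ 7`, both radii small as above).
[cite: Balaban1985RegularSpaces, Lemma 1 (1.24)-(1.25) p.79; Balaban1985Variational, (14) p.280] -/
theorem norm_pertVar_le_of_combAxial_T3 (hL : 7 ≤ F.L) {ε₀ e₀ β : ℝ} (hβ : 0 ≤ β)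
    (hε : 50 * (500 * (F.L : ℝ) + 7 * (F.L : ℝ) ^ 2) * ε₀ ≤ 1) (he : 50 * (500 * (F.L : ℝ) + 7 * (F.L : ℝ) ^ 2) * e₀ ≤ 1)
    {V : GaugeField (F.P n) 0 (Matrix.specialUnitaryGroup (Fin 2) ℂ)} (W U₀ : GaugeField (F.P K) 0 (Matrix.specialUnitaryGroup (Fin 2) ℂ))
    (hW : W ∈ regFibrePr F n K h ε₀ V) (hU₀ : RegPr F n K e₀ U₀)
    (hax : ∀ x : Site (F.P K) 0, axialT W (embIter (K - n) (iterBlockOf (K - n) x)) x = axialT U₀ (embIter (K - n) (iterBlockOf (K - n) x)) x)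
    (hmid : ∀ c : PBond (F.P K) (K - n),
      dist1 (Averaging.iter (fun j => blockAvg (P := F.P K) (j := j) (ExpMeanLog.expMeanLogSU (n := Fin 2))) (K - n) W c *
        (Averaging.iter (fun j => blockAvg (P := F.P K) (j := j) (ExpMeanLog.expMeanLogSU (n := Fin 2))) (K - n) U₀ c)⁻¹) ≤ β)
    (b : PBond (F.P K) 0) : ‖pertVar U₀ W b‖ ≤ 113 * (ε₀ + e₀) + β := by
  obtain ⟨x, μ⟩ := b
  have hWr : RegPr F n K ε₀ W := ((mem_regFibrePr_iff F).mp hW).2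
  have hε₀ : 0 < ε₀ := pos_of_regPr F hWr
  have he₀ : 0 < e₀ := pos_of_regPr F hU₀
  have hk : K - n ≤ (F.P K).m + (F.P K).K := by show K - n ≤ F.m + K; omega
  have hL1 : (1 : ℝ) ≤ (F.L : ℝ) := by exact_mod_cast (show 1 ≤ F.L by omega)
  have hη : (((F.L : ℝ))⁻¹) ^ (K - n) ≤ 1 := pow_le_one₀ (inv_nonneg.mpr (by linarith)) (inv_le_one_of_one_le₀ hL1)
  have hsum : 0 ≤ ε₀ + e₀ := by linarith
  rcases face_or_interior hk x μ with hface | hint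
  · have hd := Summit.QuantumFields.YangMills.Theorems.Prop7AxialGaugeFace.dist1_mul_inv_le_face_T3 F n K hL hε₀ he₀ hε he W U₀ hWr hU₀ hax
      hmid x μ hface
    change dist1 (W ⟨x, μ⟩ * (U₀ ⟨x, μ⟩)⁻¹) ≤ _
    refine hd.trans ?_
    have hL0 : (0 : ℝ) < (F.L : ℝ) := by linarith
    have hcancel : (F.L : ℝ) ^ (2 * (K - n)) * (((F.L : ℝ))⁻¹) ^ (2 * (K - n)) = 1 := by
      rw [← mul_pow, mul_inv_cancel₀ hL0.ne', one_pow]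
    have : (100 * (F.L : ℝ) ^ (2 * (K - n)) + (7 * (F.L : ℝ) ^ (K - n)) ^ 2 / 4) * (regThreshold F n K ε₀ + regThreshold F n K e₀) =
        (449 / 4) * (ε₀ + e₀) := by
      have h7 : (7 * (F.L : ℝ) ^ (K - n)) ^ 2 = 49 * (F.L : ℝ) ^ (2 * (K - n)) := by rw [mul_pow, ← pow_mul, mul_comm (K - n) 2]; norm_num
      rw [h7]
      unfold regThreshold
      linear_combination (449 / 4) * (ε₀ + e₀) * hcancel
    rw [this]
    linarith
  · have hd := norm_pertVar_le_interior_T3 F n K hε₀.le he₀.le W U₀ hWr hU₀ hax x μ hint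
    refine hd.trans ?_
    nlinarith

end Lemma1

end Summit.QuantumFields.YangMills.Theorems.Prop7AxialLemma1

end
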